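import Summits.ResolutionOfSingularities.ResolutionOfSingularities.Theorems.FrobeniusLadderFInjectiveMacaulayficationF108ConsumableHolds
import HarnessLib

/-!
# TOWARD `F108ConsumableRel_holds` (the RELATIVE interface of ✓p685336) ON TOP OF res-L1-toric-fan's F-108 ENGINE, stage 1/2: goodness for a Minkowski SUM of exponent sets splits, and
# the invariant bundle `Inv` survives SHIFTING every vertex `m_d` by the cone's minimiser `b_d` of a second exponent set — hence Minkowski–Weyl (the Rees cover) for the SUM polyhedron
# (crux `FInjectiveMacaulayfication` stmt-ResolutionOfSingularities-15315, chain w45a; res-L1-w45a-plan-1 «OPEN ITEM (no owner tonight): `F108ConsumableRel_holds`» + this seat's TAKING line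
# 02:31Z; seat res-L1-w45a-stub-1 g14; NOTHING of res-L1-toric-fan's files is modified — their `Inv`, `Good`, `exists_inv_good_convenient`, `Inv.mw_int` are used as black boxes)

[OURS · L1 W4.5a] Support file (`--supports stmt-ResolutionOfSingularities-15315 --as helper`); one bookkeeping definition (`shiftD`, the vertex-shifted decorated cone) and lemmas;
UNCONDITIONAL; no named fact. Finitary statements over `ℤ` only; nothing of the crux is proved. AI-written (AI review is weaker than expert review).

THE OBSERVATION. In res-L1-toric-fan's construction the vertex decoration `m` and the whole bundle `Inv` do not mention the exponent set; `Good 𝒜 d` («`𝒜` has a common minimiser on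
the rays of `d`») is separate. (1) `Good (E + B) d → Good E d ∧ Good B d` for the sumset `E + B` (a common minimiser `e₀ + b₀` of the sum splits) — so ONE run of their
`exists_inv_good_convenient` on `supp f + B` yields a state good for `supp f` AND for `B`. (2) Replacing every vertex `m_d` by `m_d + b_d`, `b_d` the `B`-minimiser on `d`, keeps `Inv`:
strict concavity (the `b`-part of `⟨ρ, m′_{d′} − m′_d⟩` is `≥ 0` and vanishes exactly on shared rays), `𝔪`-domination and neighbour membership (the `b`-part is `≥ 0`), boundary
vanishing (`B` has a pure power of every variable, so its minimum on a ray with a zero coordinate is `0`), positivity. (3) Hence their `Inv.mw_int` applied to the shifted state is the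
integral Minkowski–Weyl certificate for the polyhedron with vertices `m_d + b_d` — the Rees cover `hcov` of the relative tables `A = B + 𝔪·K` (stage 2).
* §1 `good_fst_of_good_sum`, `good_snd_of_good_sum`.
* §2 `shiftD`, `shiftD_ray/m/w/l/rays`, `shiftD_injective`, ★ `inv_shift`.
* §3 ★ `mw_int_shift`.
[cite: CoxLittleSchenck2011, Thm. 11.1.9 and §11.4 (guide only; nothing used as a fact)]
-/

set_option linter.dupNamespace false

noncomputable section

namespace Summit.ResolutionOfSingularities.ResolutionOfSingularities.Theorems.FInjectiveMacaulayfication.F108RelToric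

open Matrix Finset
open Summit.ResolutionOfSingularities.ResolutionOfSingularities.Theorems.FInjectiveMacaulayfication.F108Toric

variable {n : ℕ}

/-! ## §1 Goodness for a sum of exponent sets splits -/

/-- A common minimiser of the SUMSET `E + B` on the rays of `d` yields a common minimiser of `E`. [OURS · elementary] -/
theorem good_fst_of_good_sum {E B : Finset (Fin n → ℤ)} {d : DCone n} (h : Good ((E ×ˢ B).image fun q => q.1 + q.2) d) : Good E d := by
  classical
  obtain ⟨s, hs, hmin⟩ := h
  obtain ⟨⟨e₀, b₀⟩, hq, rfl⟩ := mem_image.1 hs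
  obtain ⟨he₀, hb₀⟩ := mem_product.1 hq
  refine ⟨e₀, he₀, fun i e he => ?_⟩
  have h := hmin i (e + b₀) (mem_image.2 ⟨(e, b₀), mem_product.2 ⟨he, hb₀⟩, rfl⟩)
  simp only [dotProduct_add] at h
  linarith

/-- … and a common minimiser of `B`. [OURS · elementary] -/
theorem good_snd_of_good_sum {E B : Finset (Fin n → ℤ)} {d : DCone n} (h : Good ((E ×ˢ B).image fun q => q.1 + q.2) d) : Good B d := by
  classical
  obtain ⟨s, hs, hmin⟩ := h
  obtain ⟨⟨e₀, b₀⟩, hq, rfl⟩ := mem_image.1 hs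
  obtain ⟨he₀, hb₀⟩ := mem_product.1 hq
  refine ⟨b₀, hb₀, fun i b hb => ?_⟩
  have h := hmin i (e₀ + b) (mem_image.2 ⟨(e₀, b), mem_product.2 ⟨he₀, hb⟩, rfl⟩)
  simp only [dotProduct_add] at h
  linarith

/-! ## §2 The vertex-shifted state and its invariant bundle -/

/-- The decorated cone with its vertex shifted by `b (rays)` (the shift depends on the ray matrix only, so that shifting is injective on a state). [OURS · bookkeeping] -/
def shiftD (b : (Fin n → Fin n → ℤ) → Fin n → ℤ) (d : DCone n) : DCone n := ⟨d.ray, d.m + b d.ray, d.w, d.l⟩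

/-- Under `shiftD`, the rays are unchanged. [OURS · bookkeeping] -/
@[simp] theorem shiftD_ray (b : (Fin n → Fin n → ℤ) → Fin n → ℤ) (d : DCone n) : (shiftD b d).ray = d.ray := rfl
/-- Under `shiftD`, the vertex is shifted by `b d.ray`. [OURS · bookkeeping] -/
@[simp] theorem shiftD_m (b : (Fin n → Fin n → ℤ) → Fin n → ℤ) (d : DCone n) : (shiftD b d).m = d.m + b d.ray := rfl
/-- Under `shiftD`, the dual basis is unchanged. [OURS · bookkeeping] -/
@[simp] theorem shiftD_w (b : (Fin n → Fin n → ℤ) → Fin n → ℤ) (d : DCone n) : (shiftD b d).w = d.w := rfl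
/-- Under `shiftD`, the minimal coordinate is unchanged. [OURS · bookkeeping] -/
@[simp] theorem shiftD_l (b : (Fin n → Fin n → ℤ) → Fin n → ℤ) (d : DCone n) : (shiftD b d).l = d.l := rfl
/-- Under `shiftD`, the ray set is unchanged. [OURS · bookkeeping] -/
@[simp] theorem shiftD_rays (b : (Fin n → Fin n → ℤ) → Fin n → ℤ) (d : DCone n) : (shiftD b d).rays = d.rays := rfl

/-- Shifting is injective. [OURS · bookkeeping] -/
theorem shiftD_injective (b : (Fin n → Fin n → ℤ) → Fin n → ℤ) : Function.Injective (shiftD (n := n) b) := by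
  intro x y h
  obtain ⟨xr, xm, xw, xl⟩ := x
  obtain ⟨yr, ym, yw, yl⟩ := y
  simp only [shiftD, DCone.mk.injEq] at h
  obtain ⟨hr, hm, hw, hl⟩ := h
  subst hr; subst hw; subst hl
  have : xm = ym := by
    funext j; have := congrFun hm j; simp only [Pi.add_apply] at this; linarith
  subst this
  rfl

/-- ★ **THE INVARIANT BUNDLE SURVIVES THE SHIFT `m_d ↦ m_d + b_d`** when the shifts are nonnegative, vanish on boundary rays, and are CROSS-MINIMAL (`⟨ρ, b_d⟩ ≤ ⟨ρ, b_{d′}⟩` for every ray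
`ρ` of `d`) — as is the case for the minimisers of a fixed exponent set containing a pure power of every variable. [OURS · bookkeeping] -/
theorem inv_shift {S : Finset (DCone n)} (hS : F108Toric.Inv S) (b : (Fin n → Fin n → ℤ) → Fin n → ℤ)
    (hb0 : ∀ d ∈ S, ∀ j, 0 ≤ b d.ray j)
    (hbdry : ∀ d ∈ S, ∀ i, (∃ j, d.ray i j = 0) → d.ray i ⬝ᵥ b d.ray = 0)
    (hmin : ∀ d ∈ S, ∀ d' ∈ S, ∀ i, d.ray i ⬝ᵥ b d.ray ≤ d.ray i ⬝ᵥ b d'.ray) :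
    F108Toric.Inv (S.image (shiftD b)) := by
  classical
  have pre : ∀ {D : DCone n}, D ∈ S.image (shiftD b) → ∃ d ∈ S, shiftD b d = D := fun hD => by
    obtain ⟨d, hd, h⟩ := mem_image.1 hD; exact ⟨d, hd, h⟩
  refine ⟨?_, ?_, ?_, ?_, ?_, ?_, ?_, ?_, ?_, ?_, ?_⟩
  · intro D hD; obtain ⟨d, hd, rfl⟩ := pre hD; exact hS.nonneg d hd
  · intro D hD; obtain ⟨d, hd, rfl⟩ := pre hD; exact hS.stdOrPos d hd
  · intro D hD; obtain ⟨d, hd, rfl⟩ := pre hD; exact hS.dual d hd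
  · intro D hD; obtain ⟨d, hd, rfl⟩ := pre hD; exact hS.lmin d hd
  · intro D hD i hi; obtain ⟨d, hd, rfl⟩ := pre hD
    rw [shiftD_m, shiftD_ray, dotProduct_add, hS.bdry d hd i hi, hbdry d hd i hi, add_zero]
  · intro D hD j; obtain ⟨d, hd, rfl⟩ := pre hD
    rw [shiftD_m, Pi.add_apply]; exact add_nonneg (hS.mnonneg d hd j) (hb0 d hd j)
  · intro D hD; obtain ⟨d, hd, rfl⟩ := pre hD
    rw [shiftD_m, shiftD_l, Pi.add_apply]; linarith [hS.mlpos d hd, hb0 d hd d.l]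
  · -- strict concavity
    intro D hD D' hD' i; obtain ⟨d, hd, rfl⟩ := pre hD; obtain ⟨d', hd', rfl⟩ := pre hD'
    rw [shiftD_m, shiftD_m, shiftD_ray, shiftD_rays, show d'.m + b d'.ray - (d.m + b d.ray) = (d'.m - d.m) + (b d'.ray - b d.ray) by abel,
      dotProduct_add]
    have h1 : 0 ≤ d.ray i ⬝ᵥ (d'.m - d.m) := hS.sc_nonneg hd hd' i
    have h2 : 0 ≤ d.ray i ⬝ᵥ (b d'.ray - b d.ray) := by rw [dotProduct_sub]; linarith [hmin d hd d' hd' i]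
    constructor
    · intro h
      exact (hS.sc d hd d' hd' i).1 (by linarith)
    · intro h
      have hm : d.ray i ⬝ᵥ (d'.m - d.m) = 0 := (hS.sc d hd d' hd' i).2 h
      obtain ⟨j, hj⟩ := mem_rays.1 h
      have h3 : d.ray i ⬝ᵥ b d'.ray ≤ d.ray i ⬝ᵥ b d.ray := by rw [← hj]; exact hmin d' hd' d hd j
      rw [hm, dotProduct_sub]; linarith [hmin d hd d' hd' i]
  · -- 𝔪-domination
    intro D hD D' hD' i; obtain ⟨d, hd, rfl⟩ := pre hD; obtain ⟨d', hd', rfl⟩ := pre hD'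
    rw [shiftD_m, shiftD_m, shiftD_ray, shiftD_l, shiftD_l, show d'.m + b d'.ray - (d.m + b d.ray) = (d'.m - d.m) + (b d'.ray - b d.ray) by abel,
      dotProduct_add]
    have h2 : 0 ≤ d.ray i ⬝ᵥ (b d'.ray - b d.ray) := by rw [dotProduct_sub]; linarith [hmin d hd d' hd' i]
    linarith [hS.dom d hd d' hd' i]
  · -- neighbour membership
    intro D hD i; obtain ⟨d, hd, rfl⟩ := pre hD
    rcases hS.amem d hd i with h | h
    · left
      intro D'' hD'' j; obtain ⟨d'', hd'', rfl⟩ := pre hD''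
      rw [shiftD_ray, shiftD_l, shiftD_l, shiftD_m, shiftD_m, shiftD_w,
        show d.m + b d.ray + d.w i - (d''.m + b d''.ray) = (d.m + d.w i - d''.m) + (b d.ray - b d''.ray) by abel, dotProduct_add]
      have h2 : 0 ≤ d''.ray j ⬝ᵥ (b d.ray - b d''.ray) := by rw [dotProduct_sub]; linarith [hmin d'' hd'' d hd j]
      linarith [h d'' hd'' j]
    · right; rw [shiftD_w, shiftD_l]; exact h
  · -- completeness
    intro x hx
    obtain ⟨d, hd, c, hc, hxc⟩ := hS.complete x hx
    exact ⟨shiftD b d, mem_image_of_mem _ hd, c, hc, by rw [shiftD_ray]; exact hxc⟩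

/-! ## §3 ★ Minkowski–Weyl for the shifted vertices -/

/-- ★ **INTEGRAL MINKOWSKI–WEYL FOR THE SUM POLYHEDRON**: every lattice point `u` with `⟨ρ, u⟩ ≥ ⟨ρ, m_d + b_d⟩` for every ray `ρ` of every cone `d` dominates, after scaling by some
`D ≥ 1`, a nonnegative integral combination of the shifted vertices with total weight `D` (res-L1-toric-fan's `Inv.mw_int` on the shifted state). [OURS · bookkeeping] -/
theorem mw_int_shift {S : Finset (DCone n)} (hS : F108Toric.Inv S) (b : (Fin n → Fin n → ℤ) → Fin n → ℤ)
    (hb0 : ∀ d ∈ S, ∀ j, 0 ≤ b d.ray j)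
    (hbdry : ∀ d ∈ S, ∀ i, (∃ j, d.ray i j = 0) → d.ray i ⬝ᵥ b d.ray = 0)
    (hmin : ∀ d ∈ S, ∀ d' ∈ S, ∀ i, d.ray i ⬝ᵥ b d.ray ≤ d.ray i ⬝ᵥ b d'.ray)
    (u : Fin n → ℤ) (hu : ∀ d ∈ S, ∀ i, d.ray i ⬝ᵥ (d.m + b d.ray) ≤ d.ray i ⬝ᵥ u) :
    ∃ D : ℕ, ∃ μ : DCone n → ℕ, 1 ≤ D ∧ ∑ d ∈ S, μ d = D ∧ ∀ j, ∑ d ∈ S, (μ d : ℤ) * (d.m j + b d.ray j) ≤ (D : ℤ) * u j := by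
  classical
  have hS' := inv_shift hS b hb0 hbdry hmin
  obtain ⟨D, μ, hD, hsum, hle⟩ := hS'.mw_int u (by
    intro D hD i
    obtain ⟨d, hd, rfl⟩ := mem_image.1 hD
    rw [shiftD_ray, shiftD_m]; exact hu d hd i)
  have hinj : ∀ x ∈ S, ∀ y ∈ S, shiftD b x = shiftD b y → x = y := fun x _ y _ h => shiftD_injective b h
  rw [sum_image hinj] at hsum
  refine ⟨D, fun d => μ (shiftD b d), hD, hsum, fun j => ?_⟩
  have h := hle j
  rw [sum_image hinj] at h
  simpa only [shiftD_m, Pi.add_apply] using h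

end Summit.ResolutionOfSingularities.ResolutionOfSingularities.Theorems.FInjectiveMacaulayfication.F108RelToric

end
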